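import Literature.AlgebraicTopology.SingularHomology.TwoPieceProductCohomology
import Literature.AlgebraicTopology.SingularHomology.CechTautness
import Literature.AlgebraicTopology.SingularHomology.CohomologyHomotopyInvariance
import Mathlib.Topology.LocalAtTarget
import HarnessLib

/-!
# Relative tautness and excision for relative homeomorphisms of taut pairs

E. H. Spanier, *Algebraic Topology* (1966), Ch. 6 §1 (taut subspaces, Thm. 6.1.10) and §6
(p. 318, "strong excision property": a closed continuous map `f : (X', K') → (X, K)` with
`f⁻¹(K) = K'` which maps `X' ∖ K'` homeomorphically onto `X ∖ K` — a *relative homeomorphism* —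
induces isomorphisms `H̄^*(X, K) ≅ H̄^*(X', K')` of Alexander–Spanier (= Čech) cohomology, Thm. 6.6.5;
for TAUT pairs these agree with singular cohomology, Cor. 6.6.7 ff.); A. Hatcher, *Algebraic
Topology* (2002), Prop. 2.22 / §3.1 p. 201 (for good pairs `Hⁿ(X, A) ≅ H̃ⁿ(X/A)`, whence
invariance under relative homeomorphisms of compact good pairs).

This file proves the singular-cohomology statement DIRECTLY from the tree's tautness datum
`Cech.RetractionNhds K` (`CechTautness.lean`: an open `U₀ ⊇ K` retracting onto `K` and, inside
every neighbourhood, a smaller one deforming into `K`), the long exact sequence of the pair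
(`RelativeCochains.lean`), maps of pairs and naturality of `δ` (`RelativeCochainsMaps.lean`) and
open excision (`RelativeCochainsExcision.lean`), with no direct limits:

* `Cech.RetractionNhds.exists_isOpen_map_inclusion_eq_zero` / `exists_map_inclusion_eq` —
  absolute tautness in `∃`-form: a class on a neighbourhood `U ⊆ U₀` of `K` dying on `K` dies on
  a smaller neighbourhood; every class of `K` extends to `U₀`;
* **relative tautness** `Cech.RetractionNhds.exists_isOpen_resPair_eq` (every class of
  `Hⁿ(X, K)` is the restriction of a class of `Hⁿ(X, W)` for some open `W ⊇ K`) and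
  `Cech.RetractionNhds.exists_isOpen_resPair_eq_zero` (a class of `Hⁿ(X, W)` dying in `Hⁿ(X, K)`
  dies in `Hⁿ(X, W')` for some open `K ⊆ W' ⊆ W`), by chasing the long exact sequences of the
  pairs `(X, K)`, `(X, W)` (Spanier 6.6.3 for the singular theory of a taut pair);
* `bijective_relMap_preimage_of_isOpen` — for a relative homeomorphism `f` and an OPEN `V ⊇ K`,
  `f^* : Hⁿ(X, V) → Hⁿ(X', f⁻¹V)` is bijective (open excision of the closed `K`, resp. `f⁻¹K`,
  and the homeomorphism of pairs `(X' ∖ f⁻¹K, f⁻¹V ∖ f⁻¹K) ≃ (X ∖ K, V ∖ K)`);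
* **`bijective_relMap_of_relativeHomeomorph`** — THE THEOREM: for `K ⊆ X` closed with tautness
  data for `K ⊆ X` and for `f⁻¹K ⊆ X'`, and `f : X' → X` continuous and closed, injective off
  `f⁻¹K` and with `X ∖ K ⊆ f(X')`, the map `f^* : Hⁿ(X, K; M) → Hⁿ(X', f⁻¹K; M)` is bijective
  for every `n` and every coefficient module `M` (Spanier Thm. 6.6.5 + tautness).

The consumers are the complex points of proper birational morphisms of complex projective
varieties (`Literature/AlgebraicGeometry/HodgeTheory/`): compact, locally contractible subsets of
compact manifolds carry tautness data (`Cech.RetractionNhds.nonempty_of_locallyContractibleSpace`).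
Everything is proved; no definitions (`resPair[h, n]` is a notation), no named facts.

## References

* E. H. Spanier, *Algebraic Topology*, Springer 1981 (1966), Ch. 6 §1 Thm. 10, §6 Thm. 5
  (p. 318) and Thm. 3. [Spanier1981]
* A. Hatcher, *Algebraic Topology*, CUP 2002, Prop. 2.22, §3.1 pp. 199–201. [HatcherAT2002]
-/

noncomputable section

open CategoryTheory Set
open _root_.Topology

universe u v

namespace Literature.AlgebraicTopology.SingularHomology

variable {R : Type v} [CommRing R] {M : Type v} [AddCommGroup M] [Module R M]
variable {X X' : Type u} [TopologicalSpace X] [TopologicalSpace X']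

/-- A `ModuleCat` isomorphism is a bijection. [folklore] -/
private theorem bijective_of_isIso_aux {A B : ModuleCat.{max u v} R} (φ : A ⟶ B) [IsIso φ] :
    Function.Bijective φ :=
  (asIso φ).toLinearEquiv.bijective

/-! ### Restriction between pairs `(X, A) → (X, B)` for `A ⊆ B` -/

/-- For `A ⊆ B` the identity is a map of pairs `(X, A) → (X, B)`. [folklore] -/
theorem relSingularCohomology.mapsTo_id_of_subset {A B : Set X} (h : A ⊆ B) :
    MapsTo (ContinuousMap.id X) A B :=
  fun _ hx ↦ h hx

/-- `resPair[h, n] : Hⁿ(X, B; M) ⟶ Hⁿ(X, A; M)`, the restriction along the map of pairs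
`𝟙 : (X, A) → (X, B)` for `h : A ⊆ B` (Hatcher 2002, §3.1 p. 200) — a file-local NOTATION for
`relSingularCohomology.map R M (ContinuousMap.id _) (relSingularCohomology.mapsTo_id_of_subset h) n`
(the coefficient names `R`, `M` are those of the ambient context). -/
local notation3 (prettyPrint := false) "resPair[" h ", " n "]" =>
  relSingularCohomology.map R M (ContinuousMap.id _) (relSingularCohomology.mapsTo_id_of_subset h) n

namespace relSingularCohomology

/-- `resPair` is transitive. [folklore] -/
lemma resPair_comp {A B C : Set X} (hAB : A ⊆ B) (hBC : B ⊆ C) (n : ℕ) :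
    resPair[hBC, n] ≫ resPair[hAB, n] = resPair[hAB.trans hBC, n] := by
  rw [← map_comp]
  rfl

/-- `resPair` is compatible with `Hⁿ(X, ·) → Hⁿ(X)`. [cite: HatcherAT2002, §3.1 p. 200] -/
lemma resPair_comp_toAbsolute {A B : Set X} (h : A ⊆ B) (n : ℕ) :
    resPair[h, n] ≫ toAbsolute R M X A n = toAbsolute R M X B n := by
  rw [map_comp_toAbsolute, singularCohomology.map_id]
  exact Category.comp_id _

/-- Naturality of `δ` under `resPair`: `δ_B ≫ res = (A ↪ B)^* ≫ δ_A`. [cite: HatcherAT2002, §3.1 p. 200] -/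
lemma δ_comp_resPair {A B : Set X} (h : A ⊆ B) (i j : ℕ) (hij : i + 1 = j) :
    δ R M X B i j hij ≫ resPair[h, j] =
      singularCohomology.map R M (subsetInclusion h) i ≫ δ R M X A i j hij :=
  δ_comp_map (ContinuousMap.id X) (fun _ hx ↦ h hx) i j hij

/-- A map of pairs `f : (X', A') → (X, A)` commutes with the restrictions to larger subsets:
`f^*_{(B)} ≫ res' = res ≫ f^*_{(A)}` for `A ⊆ B`, `A' ⊆ B'`, `f(A') ⊆ A`, `f(B') ⊆ B`. [folklore] -/
lemma map_comp_resPair {A B : Set X} {A' B' : Set X'} (f : C(X', X)) (hA : MapsTo f A' A)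
    (hB : MapsTo f B' B) (h : A ⊆ B) (h' : A' ⊆ B') (n : ℕ) :
    map R M f hB n ≫ resPair[h', n] = resPair[h, n] ≫ map R M f hA n := by
  rw [← map_comp, ← map_comp]
  rfl

end relSingularCohomology

open relSingularCohomology

/-! ### Absolute tautness in `∃`-form -/

namespace Cech.RetractionNhds

variable {K : Set X}

/-- **Tautness, injectivity, `∃`-form** (Spanier 1966, proof of Thm. 6.1.10): for a tautness
datum of `K ⊆ X`, an open `U` with `K ⊆ U ⊆ U₀` and a class `y ∈ Hᵏ(U; M)` vanishing on `K`, there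
is an open `V` with `K ⊆ V ⊆ U` and `y|_V = 0` — on the `V` of the datum the inclusion `V ↪ U` is
homotopic to `V →ʳ K ↪ U`. [cite: Spanier1981, Ch. 6 §1, Thm. 10] -/
theorem exists_isOpen_map_inclusion_eq_zero (T : RetractionNhds K) {U : Set X} (hU : IsOpen U)
    (hKU : K ⊆ U) (hU₀ : U ⊆ T.U₀) {k : ℕ} (y : singularCohomology R M U k)
    (hy : singularCohomology.map R M (subsetInclusion hKU) k y = 0) :
    ∃ V : Set X, IsOpen V ∧ K ⊆ V ∧ ∃ hVU : V ⊆ U,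
      singularCohomology.map R M (subsetInclusion hVU) k y = 0 := by
  obtain ⟨V, hVo, hKV, hVU, hhom⟩ := T.homotopic U hU hKU hU₀
  refine ⟨V, hVo, hKV, hVU, ?_⟩
  change singularCohomology.map R M (ContinuousMap.inclusion hVU) k y = 0
  rw [singularCohomology.map_eq_of_homotopic' (R := R) (M := M) hhom k,
    singularCohomology.map_comp, ModuleCat.comp_apply]
  change singularCohomology.map R M _ k (singularCohomology.map R M (subsetInclusion hKU) k y) = 0
  rw [hy, map_zero]

/-- **Tautness, surjectivity, `∃`-form** (Spanier 1966, proof of Thm. 6.1.10): every class of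
`Hᵏ(K; M)` is the restriction of a class of `Hᵏ(U₀; M)`, namely of its pull-back along the
retraction. [cite: Spanier1981, Ch. 6 §1, Thm. 10] -/
theorem exists_map_inclusion_eq (T : RetractionNhds K) {k : ℕ} (e : singularCohomology R M K k) :
    ∃ y : singularCohomology R M T.U₀ k,
      singularCohomology.map R M (subsetInclusion T.subset) k y = e := by
  refine ⟨singularCohomology.map R M T.r k e, ?_⟩
  rw [← ModuleCat.comp_apply, ← singularCohomology.map_comp]
  change singularCohomology.map R M (T.r.comp (ContinuousMap.inclusion T.subset)) k e = e
  rw [T.r_comp_inclusion, singularCohomology.map_id]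
  rfl

/-! ### Relative tautness -/

/-- **Relative tautness, surjectivity** (Spanier 1966, Ch. 6 §6 Thm. 3 for the singular theory
of a taut pair): every class `b ∈ Hⁿ(X, K; M)` is the restriction of a class of `Hⁿ(X, W; M)` for
some open `W ⊇ K`. Chase: `b ↦ b' ∈ Hⁿ(X)` dies on `K`, hence on an open `W₁ ⊇ K` (tautness), so
`b' = j(c₁)` with `c₁ ∈ Hⁿ(X, W₁)`; `b - c₁|_{(X,K)} = δ e` with `e ∈ Hⁿ⁻¹(K)`, and `e = y|_K`
with `y ∈ Hⁿ⁻¹(U₀)` (tautness); then on `W = W₁ ∩ U₀`, `b = (δ_W y|_W + c₁|_{(X,W)})|_{(X,K)}` by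
naturality of `δ`. [cite: Spanier1981, Ch. 6 §6, Thm. 3] -/
theorem exists_isOpen_resPair_eq (T : RetractionNhds K) (n : ℕ)
    (b : relSingularCohomology R M X K n) :
    ∃ W : Set X, IsOpen W ∧ ∃ hKW : K ⊆ W, ∃ c : relSingularCohomology R M X W n,
      resPair[hKW, n] c = b := by
  -- `b' = toAbsolute b` dies on `K`, hence on a neighbourhood `W₁ ⊆ U₀`
  set b' := toAbsolute R M X K n b with hb'
  have hb'K : singularCohomology.map R M (subsetIncl K) n b' = 0 := by
    rw [hb', ← ModuleCat.comp_apply, toAbsolute_comp_map_subsetIncl R M K n]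
    rfl
  have hb'U : singularCohomology.map R M (subsetInclusion T.subset) n
      (singularCohomology.map R M (subsetIncl T.U₀) n b') = 0 := by
    rw [← ModuleCat.comp_apply, ← singularCohomology.map_comp]
    exact hb'K
  obtain ⟨W₁, hW₁o, hKW₁, hW₁U, hW₁⟩ :=
    T.exists_isOpen_map_inclusion_eq_zero T.isOpen T.subset Subset.rfl _ hb'U
  rw [← ModuleCat.comp_apply, ← singularCohomology.map_comp] at hW₁
  have hW₁' : singularCohomology.map R M (subsetIncl W₁) n b' = 0 := hW₁
  -- so `b' = toAbsolute c₁` with `c₁ ∈ Hⁿ(X, W₁)`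
  obtain ⟨c₁, hc₁⟩ := (ShortComplex.moduleCat_exact_iff _).1
    (exact_toAbsolute_map (R := R) (M := M) W₁ n) b' hW₁'
  -- `d = b - c₁|` has `toAbsolute d = 0`
  set d := b - resPair[hKW₁, n] c₁ with hd
  have hd0 : toAbsolute R M X K n d = 0 := by
    rw [hd, map_sub, ← ModuleCat.comp_apply, resPair_comp_toAbsolute hKW₁ n]
    change b' - toAbsolute R M X W₁ n c₁ = 0
    rw [hc₁, sub_self]
  rcases n with _ | i
  · -- degree `0`: `toAbsolute` is injective, so `d = 0`
    have hd' : d = 0 := toAbsolute_zero_injective R M K (hd0.trans (map_zero _).symm)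
    rw [hd, sub_eq_zero] at hd'
    exact ⟨W₁, hW₁o, hKW₁, c₁, hd'.symm⟩
  · -- positive degree: `d = δ e`, `e = y|_K`, `y ∈ Hⁱ(U₀)`
    obtain ⟨e, he⟩ := (ShortComplex.moduleCat_exact_iff _).1
      (exact_δ_toAbsolute (R := R) (M := M) K i (i + 1) rfl) d hd0
    obtain ⟨y, hy⟩ := T.exists_map_inclusion_eq (R := R) (M := M) e
    -- the neighbourhood `W = W₁ ∩ U₀`
    have hKW : K ⊆ W₁ ∩ T.U₀ := subset_inter hKW₁ T.subset
    set z := singularCohomology.map R M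
      (subsetInclusion (inter_subset_right : W₁ ∩ T.U₀ ⊆ T.U₀)) i y with hz
    have h1 : resPair[hKW, (i + 1)] (δ R M X (W₁ ∩ T.U₀) i (i + 1) rfl z) =
        δ R M X K i (i + 1) rfl (singularCohomology.map R M (subsetInclusion hKW) i z) := by
      rw [← ModuleCat.comp_apply, δ_comp_resPair hKW i (i + 1) rfl, ModuleCat.comp_apply]
    have h2 : singularCohomology.map R M (subsetInclusion hKW) i z = e := by
      rw [hz, ← ModuleCat.comp_apply, ← singularCohomology.map_comp]
      exact hy
    have h3 : resPair[hKW, (i + 1)] (resPair[inter_subset_left, (i + 1)] c₁) =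
        resPair[hKW₁, (i + 1)] c₁ := by
      rw [← ModuleCat.comp_apply, resPair_comp hKW inter_subset_left (i + 1)]
    refine ⟨W₁ ∩ T.U₀, hW₁o.inter T.isOpen, hKW,
      δ R M X (W₁ ∩ T.U₀) i (i + 1) rfl z + resPair[inter_subset_left, (i + 1)] c₁, ?_⟩
    rw [map_add, h1, h2, he, h3, hd, sub_add_cancel]

/-- **Relative tautness, injectivity** (Spanier 1966, Ch. 6 §6 Thm. 3 for a taut pair): for an
open `W ⊇ K` and `c ∈ Hⁿ(X, W; M)` whose restriction to `Hⁿ(X, K; M)` vanishes, there is an open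
`W'` with `K ⊆ W' ⊆ W` such that `c` already vanishes in `Hⁿ(X, W'; M)`. Chase: `toAbsolute c = 0`,
so `c = δ_W e`; `δ_K (e|_K) = 0` gives `e|_K = x|_K` for a global class `x`; `e - x|_W` dies on `K`,
hence on some `W' ⊆ W ∩ U₀` (tautness), and there `c|_{(X,W')} = δ_{W'}(x|_{W'}) = 0`.
[cite: Spanier1981, Ch. 6 §6, Thm. 3] -/
theorem exists_isOpen_resPair_eq_zero (T : RetractionNhds K) (n : ℕ) {W : Set X} (hW : IsOpen W)
    (hKW : K ⊆ W) (c : relSingularCohomology R M X W n) (hc : resPair[hKW, n] c = 0) :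
    ∃ W' : Set X, IsOpen W' ∧ ∃ _ : K ⊆ W', ∃ hW'W : W' ⊆ W, resPair[hW'W, n] c = 0 := by
  have hc0 : toAbsolute R M X W n c = 0 := by
    rw [← resPair_comp_toAbsolute hKW n, ModuleCat.comp_apply, hc, map_zero]
  rcases n with _ | i
  · have hc' : c = 0 := toAbsolute_zero_injective R M W (hc0.trans (map_zero _).symm)
    exact ⟨W, hW, hKW, Subset.rfl, by rw [hc', map_zero]⟩
  · obtain ⟨e, he⟩ := (ShortComplex.moduleCat_exact_iff _).1
      (exact_δ_toAbsolute (R := R) (M := M) W i (i + 1) rfl) c hc0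
    -- `δ_K (e|_K) = 0`, so `e|_K = x|_K`
    have hδe : δ R M X K i (i + 1) rfl (singularCohomology.map R M (subsetInclusion hKW) i e) = 0 := by
      rw [← ModuleCat.comp_apply, ← δ_comp_resPair hKW i (i + 1) rfl, ModuleCat.comp_apply, he, hc]
    obtain ⟨x, hx⟩ := (ShortComplex.moduleCat_exact_iff _).1
      (exact_map_δ (R := R) (M := M) K i (i + 1) rfl) _ hδe
    -- `e - x|_W` dies on `K`; restrict to `U = W ∩ U₀` and apply tautness
    have hKU : K ⊆ W ∩ T.U₀ := subset_inter hKW T.subset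
    set y := singularCohomology.map R M (subsetInclusion (inter_subset_left : W ∩ T.U₀ ⊆ W)) i
      (e - singularCohomology.map R M (subsetIncl W) i x) with hy
    have hyK : singularCohomology.map R M (subsetInclusion hKU) i y = 0 := by
      have h1 : singularCohomology.map R M (subsetInclusion hKU) i y =
          singularCohomology.map R M (subsetInclusion hKW) i
            (e - singularCohomology.map R M (subsetIncl W) i x) := by
        rw [hy, ← ModuleCat.comp_apply, ← singularCohomology.map_comp]
        rfl
      rw [h1, map_sub, ← ModuleCat.comp_apply (singularCohomology.map R M (subsetIncl W) i),
        ← singularCohomology.map_comp]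
      change _ - singularCohomology.map R M (subsetIncl K) i x = 0
      rw [hx, sub_self]
    obtain ⟨W', hW'o, hKW', hW'U, hW'⟩ :=
      T.exists_isOpen_map_inclusion_eq_zero (hW.inter T.isOpen) hKU inter_subset_right y hyK
    have hW'W : W' ⊆ W := hW'U.trans inter_subset_left
    refine ⟨W', hW'o, hKW', hW'W, ?_⟩
    -- on `W'`, `e = x|_{W'}`, and `δ` of a global class vanishes
    have heW' : singularCohomology.map R M (subsetInclusion hW'W) i e =
        singularCohomology.map R M (subsetIncl W') i x := by
      have h1 : singularCohomology.map R M (subsetInclusion hW'U) i y =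
          singularCohomology.map R M (subsetInclusion hW'W) i e -
            singularCohomology.map R M (subsetIncl W') i x := by
        rw [hy, ← ModuleCat.comp_apply, ← singularCohomology.map_comp, map_sub,
          ← ModuleCat.comp_apply (singularCohomology.map R M (subsetIncl W) i),
          ← singularCohomology.map_comp]
        rfl
      rw [h1, sub_eq_zero] at hW'
      exact hW'
    rw [← he, ← ModuleCat.comp_apply, δ_comp_resPair hW'W i (i + 1) rfl, ModuleCat.comp_apply, heW',
      ← ModuleCat.comp_apply, map_subsetIncl_comp_δ R M W' i (i + 1) rfl]
    rfl

end Cech.RetractionNhds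

/-! ### Excision for a relative homeomorphism -/

section RelativeHomeomorph

variable {K : Set X}

/-- For `V ⊆ X`, `f` is a map of pairs `(X', f⁻¹V) → (X, V)`. [folklore] -/
lemma mapsTo_preimage_pair (f : C(X', X)) (V : Set X) : MapsTo f (f ⁻¹' V) V :=
  mapsTo_preimage f V

/-- **Shrinking neighbourhoods through a closed map**: for `f` closed with `f⁻¹K ⊆ W`, `W` open,
the open set `V = (f(Wᶜ))ᶜ` contains `K` and satisfies `f⁻¹V ⊆ W` (the tube-lemma substitute
behind "proper maps are closed"). [folklore] -/
lemma exists_isOpen_preimage_subset (f : C(X', X)) (hf : IsClosedMap f) {W : Set X'}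
    (hW : IsOpen W) (hKW : f ⁻¹' K ⊆ W) :
    ∃ V : Set X, IsOpen V ∧ K ⊆ V ∧ f ⁻¹' V ⊆ W := by
  refine ⟨(f '' Wᶜ)ᶜ, (hf _ hW.isClosed_compl).isOpen_compl, fun x hx ⟨y, hy, hyx⟩ ↦ hy ?_,
    fun y hy ↦ by_contra fun hyW ↦ hy ⟨y, hyW, rfl⟩⟩
  exact hKW (show f y ∈ K by rw [hyx]; exact hx)

/-- **The homeomorphism `X' ∖ f⁻¹K ≃ₜ X ∖ K`** induced by a closed map `f` which is injective off
`f⁻¹K` with `X ∖ K ⊆ f(X')` (a closed continuous bijection is a homeomorphism; the restriction of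
a closed map over a subset of the target is closed): there is a homeomorphism of the complements
given by `f` on points. [cite: Spanier1981, Ch. 6 §6, p. 318] -/
theorem exists_complHomeomorph (f : C(X', X)) (hf : IsClosedMap f) (hinj : InjOn f (f ⁻¹' K)ᶜ)
    (hsurj : Kᶜ ⊆ range f) :
    ∃ e : ↥(f ⁻¹' K)ᶜ ≃ₜ ↥Kᶜ, ∀ x : ↥(f ⁻¹' K)ᶜ, ((e x : ↥Kᶜ) : X) = f x := by
  let g : ↥(f ⁻¹' K)ᶜ → ↥Kᶜ := fun x ↦ ⟨f x, x.2⟩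
  have hg : Function.Bijective g := by
    refine ⟨fun a b h ↦ Subtype.ext (hinj a.2 b.2 (congrArg Subtype.val h)), fun y ↦ ?_⟩
    obtain ⟨x, hx⟩ := hsurj y.2
    exact ⟨⟨x, show f x ∈ Kᶜ by rw [hx]; exact y.2⟩, Subtype.ext hx⟩
  have hgc : IsClosedMap g := hf.restrictPreimage Kᶜ
  refine ⟨{ toEquiv := Equiv.ofBijective g hg
            continuous_toFun := (f.continuous.comp continuous_subtype_val).subtype_mk _
            continuous_invFun := ?_ }, fun x ↦ rfl⟩
  rw [continuous_iff_isClosed]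
  intro s hs
  change IsClosed ((Equiv.ofBijective g hg).symm ⁻¹' s)
  rw [← Equiv.image_eq_preimage_symm]
  exact hgc s hs

/-- **`f^* : Hⁿ(X, V) → Hⁿ(X', f⁻¹V)` is bijective for every OPEN `V ⊇ K`** when `f` is a closed
relative homeomorphism off the closed set `K`: excise `K ⊆ V` (resp. `f⁻¹K ⊆ f⁻¹V`) and use the
homeomorphism of pairs `(X' ∖ f⁻¹K, f⁻¹V ∖ f⁻¹K) ≃ (X ∖ K, V ∖ K)` (Hatcher 2002, Thm. 2.20 dualised,
the tree's `relSingularCohomology.isIso_map_compl_of_closure_subset_interior`).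
[cite: HatcherAT2002, §3.1 p. 201] [cite: Spanier1981, Ch. 6 §6, Thm. 5] -/
theorem bijective_relMap_preimage_of_isOpen (f : C(X', X)) (hK : IsClosed K) (hf : IsClosedMap f)
    (hinj : InjOn f (f ⁻¹' K)ᶜ) (hsurj : Kᶜ ⊆ range f) {V : Set X} (hV : IsOpen V) (hKV : K ⊆ V)
    (n : ℕ) :
    Function.Bijective (relSingularCohomology.map R M f (mapsTo_preimage_pair f V) n) := by
  obtain ⟨e, he⟩ := exists_complHomeomorph f hf hinj hsurj
  -- the two excision isomorphisms
  have hexc : IsIso (relSingularCohomology.map R M (subsetIncl Kᶜ)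
      (mapsTo_preimage Subtype.val V : MapsTo (subsetIncl Kᶜ) (Subtype.val ⁻¹' V) V) n) :=
    relSingularCohomology.isIso_map_compl_of_closure_subset_interior R M V K
      (by rw [hK.closure_eq, hV.interior_eq]; exact hKV) n
  have hexc' : IsIso (relSingularCohomology.map R M (subsetIncl (f ⁻¹' K)ᶜ)
      (mapsTo_preimage Subtype.val (f ⁻¹' V) :
        MapsTo (subsetIncl (f ⁻¹' K)ᶜ) (Subtype.val ⁻¹' (f ⁻¹' V)) (f ⁻¹' V)) n) :=
    relSingularCohomology.isIso_map_compl_of_closure_subset_interior R M (f ⁻¹' V) (f ⁻¹' K)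
      (by
        rw [(hK.preimage f.continuous).closure_eq, (hV.preimage f.continuous).interior_eq]
        exact preimage_mono hKV) n
  -- the homeomorphism of pairs `e : (X' ∖ f⁻¹K, f⁻¹V ∖ f⁻¹K) ≃ (X ∖ K, V ∖ K)`
  have heV : MapsTo (e : C(↥(f ⁻¹' K)ᶜ, ↥Kᶜ)) (Subtype.val ⁻¹' (f ⁻¹' V)) (Subtype.val ⁻¹' V) :=
    fun x hx ↦ show ((e x : ↥Kᶜ) : X) ∈ V by rw [he x]; exact hx
  have heV' : MapsTo (e.symm : C(↥Kᶜ, ↥(f ⁻¹' K)ᶜ)) (Subtype.val ⁻¹' V) (Subtype.val ⁻¹' (f ⁻¹' V)) :=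
    fun y hy ↦ show f (e.symm y) ∈ V by
      rw [← he, e.apply_symm_apply]; exact hy
  have hee : (e.symm : C(↥Kᶜ, ↥(f ⁻¹' K)ᶜ)).comp (e : C(↥(f ⁻¹' K)ᶜ, ↥Kᶜ)) = ContinuousMap.id _ :=
    e.symm_comp_toContinuousMap
  have hee' : (e : C(↥(f ⁻¹' K)ᶜ, ↥Kᶜ)).comp (e.symm : C(↥Kᶜ, ↥(f ⁻¹' K)ᶜ)) = ContinuousMap.id _ :=
    e.toContinuousMap_comp_symm
  have hiso_e : IsIso (relSingularCohomology.map R M (e : C(↥(f ⁻¹' K)ᶜ, ↥Kᶜ)) heV n) := by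
    refine ⟨relSingularCohomology.map R M (e.symm : C(↥Kᶜ, ↥(f ⁻¹' K)ᶜ)) heV' n, ?_, ?_⟩
    · rw [← relSingularCohomology.map_comp,
        relSingularCohomology.map_congr hee' (heV.comp heV') (mapsTo_id _) n,
        relSingularCohomology.map_id]
    · rw [← relSingularCohomology.map_comp,
        relSingularCohomology.map_congr hee (heV'.comp heV) (mapsTo_id _) n,
        relSingularCohomology.map_id]
  -- the commutative square `f^* ≫ exc' = exc ≫ e^*`
  have hfe : f.comp (subsetIncl (f ⁻¹' K)ᶜ) = (subsetIncl Kᶜ).comp (e : C(↥(f ⁻¹' K)ᶜ, ↥Kᶜ)) := by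
    ext x
    exact (he x).symm
  have hsq : relSingularCohomology.map R M f (mapsTo_preimage_pair f V) n ≫
      relSingularCohomology.map R M (subsetIncl (f ⁻¹' K)ᶜ)
        (mapsTo_preimage Subtype.val (f ⁻¹' V)) n =
      relSingularCohomology.map R M (subsetIncl Kᶜ) (mapsTo_preimage Subtype.val V) n ≫
        relSingularCohomology.map R M (e : C(↥(f ⁻¹' K)ᶜ, ↥Kᶜ)) heV n := by
    rw [← relSingularCohomology.map_comp, ← relSingularCohomology.map_comp]
    exact relSingularCohomology.map_congr hfe _ _ n
  -- conclude
  have hb₁ : Function.Bijective (relSingularCohomology.map R M f (mapsTo_preimage_pair f V) n ≫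
      relSingularCohomology.map R M (subsetIncl (f ⁻¹' K)ᶜ)
        (mapsTo_preimage Subtype.val (f ⁻¹' V)) n) := by
    rw [hsq]
    haveI := hexc
    haveI := hiso_e
    exact bijective_of_isIso_aux _
  haveI := hexc'
  have hb₂ := bijective_of_isIso_aux
    (relSingularCohomology.map R M (subsetIncl (f ⁻¹' K)ᶜ) (mapsTo_preimage Subtype.val (f ⁻¹' V)) n)
  refine ⟨fun a b h ↦ hb₁.1 ?_, fun b ↦ ?_⟩
  · rw [ModuleCat.comp_apply, ModuleCat.comp_apply, h]
  · obtain ⟨a, ha⟩ := hb₁.2 (relSingularCohomology.map R M (subsetIncl (f ⁻¹' K)ᶜ)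
      (mapsTo_preimage Subtype.val (f ⁻¹' V)) n b)
    rw [ModuleCat.comp_apply] at ha
    exact ⟨a, hb₂.1 ha⟩

/-- **Relative homeomorphisms of taut pairs induce isomorphisms on relative singular
cohomology** (Spanier 1966, Ch. 6 §6 Thm. 5 "strong excision" with §1 Thm. 10 and §6 Thm. 3,
Cor. 7–9: the Alexander–Spanier groups of taut pairs are the singular ones; Hatcher 2002,
Prop. 2.22 for compact good pairs). Let `K ⊆ X` be closed, `f : X' → X` continuous and closed,
injective off `f⁻¹K` and with `X ∖ K ⊆ f(X')`, and suppose `K ⊆ X` and `f⁻¹K ⊆ X'` carry tautness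
data (`Cech.RetractionNhds`; e.g. compact locally contractible subsets of compact manifolds). Then
`f^* : Hⁿ(X, K; M) → Hⁿ(X', f⁻¹K; M)` is bijective for all `n`. Proof: relative tautness on both
sides reduces to open neighbourhoods `V ⊇ K`, `f⁻¹V ⊇ f⁻¹K` (shrunk through the closed map `f`),
where `bijective_relMap_preimage_of_isOpen` applies. [cite: Spanier1981, Ch. 6 §6, Thm. 5]
[cite: HatcherAT2002, Prop. 2.22] -/
theorem bijective_relMap_of_relativeHomeomorph (f : C(X', X)) (hK : IsClosed K)
    (hf : IsClosedMap f) (hinj : InjOn f (f ⁻¹' K)ᶜ) (hsurj : Kᶜ ⊆ range f)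
    (T : Cech.RetractionNhds K) (T' : Cech.RetractionNhds (f ⁻¹' K)) (n : ℕ) :
    Function.Bijective (relSingularCohomology.map R M f (mapsTo_preimage_pair f K) n) := by
  constructor
  · -- injectivity
    rw [injective_iff_map_eq_zero]
    intro a ha
    obtain ⟨V₀, hV₀o, hKV₀, a₀, rfl⟩ := T.exists_isOpen_resPair_eq (R := R) (M := M) n a
    -- `f^* a₀ ∈ Hⁿ(X', f⁻¹V₀)` dies in `Hⁿ(X', f⁻¹K)`, hence on some open `W ⊆ f⁻¹V₀`
    have h₁ : resPair[(preimage_mono hKV₀), n]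
        (relSingularCohomology.map R M f (mapsTo_preimage_pair f V₀) n a₀) = 0 := by
      rw [← ModuleCat.comp_apply, map_comp_resPair f (mapsTo_preimage_pair f K)
        (mapsTo_preimage_pair f V₀) hKV₀ (preimage_mono hKV₀) n, ModuleCat.comp_apply, ha]
    obtain ⟨W, hWo, hKW, hWV₀, hW⟩ := T'.exists_isOpen_resPair_eq_zero (R := R) (M := M) n
      (hV₀o.preimage f.continuous) (preimage_mono hKV₀) _ h₁
    -- shrink: `V ⊆ V₀` open around `K` with `f⁻¹V ⊆ W`
    obtain ⟨V₁, hV₁o, hKV₁, hV₁W⟩ := exists_isOpen_preimage_subset f hf hWo hKW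
    have hVo : IsOpen (V₁ ∩ V₀) := hV₁o.inter hV₀o
    have hKV : K ⊆ V₁ ∩ V₀ := subset_inter hKV₁ hKV₀
    have hVW : f ⁻¹' (V₁ ∩ V₀) ⊆ W := fun x hx ↦ hV₁W hx.1
    -- `f^* (a₀|_{(X,V)}) = (f^* a₀)|_{(X',f⁻¹V)} = 0`
    have h₂ : relSingularCohomology.map R M f (mapsTo_preimage_pair f (V₁ ∩ V₀)) n
        (resPair[inter_subset_right, n] a₀) = 0 := by
      rw [← ModuleCat.comp_apply, ← map_comp_resPair f (mapsTo_preimage_pair f (V₁ ∩ V₀))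
        (mapsTo_preimage_pair f V₀) inter_subset_right (hVW.trans hWV₀) n, ← resPair_comp hVW hWV₀ n,
        ModuleCat.comp_apply, ModuleCat.comp_apply, hW, map_zero]
    have h₃ : resPair[(inter_subset_right : V₁ ∩ V₀ ⊆ V₀), n] a₀ = 0 :=
      (bijective_relMap_preimage_of_isOpen (R := R) (M := M) f hK hf hinj hsurj hVo hKV n).1
        (h₂.trans (map_zero _).symm)
    rw [← resPair_comp hKV inter_subset_right n, ModuleCat.comp_apply, h₃, map_zero]
  · -- surjectivity
    intro b
    obtain ⟨W, hWo, hKW, c, rfl⟩ := T'.exists_isOpen_resPair_eq (R := R) (M := M) n b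
    obtain ⟨V, hVo, hKV, hVW⟩ := exists_isOpen_preimage_subset f hf hWo hKW
    obtain ⟨a, ha⟩ := (bijective_relMap_preimage_of_isOpen (R := R) (M := M) f hK hf hinj hsurj
      hVo hKV n).2 (resPair[hVW, n] c)
    refine ⟨resPair[hKV, n] a, ?_⟩
    rw [← ModuleCat.comp_apply, ← map_comp_resPair f (mapsTo_preimage_pair f K)
      (mapsTo_preimage_pair f V) hKV (preimage_mono hKV) n, ModuleCat.comp_apply, ha,
      ← ModuleCat.comp_apply, resPair_comp (preimage_mono hKV) hVW n]

end RelativeHomeomorph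

end Literature.AlgebraicTopology.SingularHomology

end
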